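import Mathlib.Analysis.Calculus.Deriv.Basic
import Mathlib.Analysis.SpecialFunctions.Exp
import Mathlib.Order.Partition.Finpartition
import Literature.Probability.LatticeModels.GaussianPairingBoundCouplings
import HarnessLib

/-!
# Camia–Jiang–Newman 2023: monotonicity of Ursell functions and of the first Lee–Yang zero
# (named facts)

Topic `Literature/Probability/LatticeModels`; cite item `wi-12270` (route
CriticalPhenomena/Ising3DConformalLimit `LeeYangGap`, support items `FirstZeroAntitoneInBeta`,
`MonotonicityTransfer`). Source: F. Camia, J. Jiang, C. M. Newman, *Monotonicity of Ursell
functions in the Ising model*, Comm. Math. Phys. 401 (2023) 2459–2482, arXiv:2207.12247, §1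
(Thm 1 = `thm:umon`, Thm 2 = `thm:1LY`, Cor 1), proofs §2–4 (random currents, switching lemma,
Shlosman's combinatorics).

SETTING (CJN §1.1, eq. (4)): the Ising model on a finite graph with FERROMAGNETIC PAIR
INTERACTIONS `J_{uv} ≥ 0`, free boundary condition, zero field:
`ℙ(σ) ∝ exp[∑_{uv ∈ E} J_{uv} σ_u σ_v]`. In the tree this is exactly the pair-interaction
average `PairIsing.avg c` of `GaussianPairingBoundCouplings.lean` on a finite set `ι` with
ordered-pair couplings `c : ι → ι → ℝ` (weight `exp(∑_{a,b} c_{a,b} σ_aσ_b)`; the graph is encoded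
by which couplings vanish, the unordered coupling of `{u,v}` is `c u v + c v u`, the diagonal is an
irrelevant constant). Over it we define

* `PairIsing.ursell c j` — the URSELL FUNCTION `u_n(σ_{j₁}, …, σ_{jₙ})` by the partition formula
  (CJN eq. (2)): `∑_𝒫 (-1)^{|𝒫|-1} (|𝒫|-1)! ∏_{P ∈ 𝒫} ⟨σ_P⟩_c` (sites may repeat);
* `PairIsing.setCoupling c u₀ v₀ t` — the couplings with the `(u₀,v₀)` entry replaced by `t`
  (to take `∂/∂J_{u₀v₀}` as a one-variable `deriv`);
* `PairIsing.mgf c lam h` — the complex moment generating function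
  `⟨exp[h ∑_u λ_u σ_u]⟩_c = Z_{c,h·λ}/Z_c` (CJN eq. (8), with the weights `λ_u` of Thm 2), `h ∈ ℂ`.

NAMED FACTS (not proved here; ~15 pp. of random-current combinatorics):
* `CamiaJiangNewman2023_thm1` — Thm 1: `(-1)^{k-1} ∂u_{2k}(σ_{j₁},…,σ_{j_{2k}})/∂J_{u₀v₀} ≥ 0` for
  all ferromagnetic `c ≥ 0`, `k ≥ 1`, sites `j`, ordered pairs `u₀ ≠ v₀` (derivative at the
  current value of the coupling; `u_{2k}` is a rational function of exponentials of the couplings,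
  hence smooth, so `deriv` is the classical derivative).
* `CamiaJiangNewman2023_thm2` — Thm 2 (Nishimori–Griffiths conjecture): for `0 ≤ c ≤ c'`
  entrywise and weights `λ ≥ 0`, `α₁(c) ≥ α₁(c')`, where `α₁` is the modulus of the first zero of
  `h ↦ ⟨exp[h ∑ λ_u σ_u]⟩`. VENDORED in the equivalent ZERO FORM "below every zero of the `c`-mgf
  (in modulus) there is a zero of the `c'`-mgf": this is what `α₁(c) ≥ α₁(c')` says once the first
  zero exists (the paper's standing presupposition; zeros exist iff `λ ≢ 0`, and the zero set of
  the entire function `mgf` is discrete so a zero of least modulus exists), and it is vacuous when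
  there are no zeros — so no junk value of a would-be `α₁ := sInf ∅` enters.

How the route's `FirstZeroAntitoneInBeta` follows (NOT done here, it needs the generalised
Lee–Yang theorem): take `ι` = the sites of the free box `Λ_M`, `c a b = β·[a ∼ b]/2`,
`c' = (β'/β) c`, `λ = 𝟙_{Λ_L}`; real zeros `θ` of `⟨cos(θ M_L)⟩_β` are the zeros `h = iθ` of the mgf
(`⟨sin(θ M_L)⟩ = 0` by spin flip), and conversely every zero of the mgf is purely imaginary
(Newman 1975, Thm 1; Nishimori–Griffiths 1983, Lemma 4.2 — the input CJN use in the proof of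
Thm 2), which turns the zero form into "`∃ θ' ∈ (0, θ]` with `⟨cos(θ' M_L)⟩_{β'} = 0`".

NOT vendored: Shlosman's signs `(-1)^{k-1} u_{2k} ≥ 0` (Shlosman 1986; CJN Remark 1), Cor 1
(`λ ≡ 1`, a special case of Thm 2), the Griffiths–Simon class extension, eq. (15)
(`1/α₁ = limsup |u_k(X)/k!|^{1/k}`).

## References
* [CamiaJiangNewman2023] as above; read via `lit read arxiv:2207.12247` (TeX chunks 3–4: §1.1–1.2
  with Thm 1, Remark 1, Thm 2, Cor 1 and the proof of Thm 2).
* S. B. Shlosman, *Signs of the Ising model Ursell functions*, Comm. Math. Phys. 102 (1986)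
  679–686 [Shlosman1986].
* H. Nishimori, R. B. Griffiths, *Structure and motion of the Lee–Yang zeros*, J. Math. Phys. 24
  (1983) 2637–2647 (the conjecture; Lemma 4.2). C. M. Newman, Comm. Math. Phys. 41 (1975), Thm 1.
-/

noncomputable section

open Finset

namespace Literature.Probability.LatticeModels

namespace PairIsing

variable {ι : Type*} [Fintype ι] [DecidableEq ι]

/-- The **Ursell function** `u_n(σ_{j 0}, …, σ_{j (n-1)})` of the spins at the sites `j` (not
necessarily distinct) under the pair-interaction average `⟨·⟩_c`, by the partition formula
`u_n = ∑_𝒫 (-1)^{|𝒫|-1} (|𝒫|-1)! ∏_{P ∈ 𝒫} ⟨∏_{i ∈ P} σ_{j i}⟩_c` over the set partitions `𝒫` of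
`{0, …, n-1}` (for `n = 0`: the empty partition, junk value `1`; used for `n ≥ 2`).
[cite: CamiaJiangNewman2023, §1.1 eq. (2)] -/
def ursell (c : ι → ι → ℝ) {n : ℕ} (j : Fin n → ι) : ℝ :=
  ∑ P : Finpartition (Finset.univ : Finset (Fin n)),
    (-1 : ℝ) ^ (P.parts.card - 1) * ((P.parts.card - 1).factorial : ℝ) *
      ∏ B ∈ P.parts, avg c (fun σ => ∏ i ∈ B, spinAt (j i) σ)

/-- The couplings `c` with the entry of the ordered pair `(u₀, v₀)` replaced by `t` (all other
entries, including `(v₀, u₀)`, unchanged). [folklore] -/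
def setCoupling (c : ι → ι → ℝ) (u₀ v₀ : ι) (t : ℝ) : ι → ι → ℝ :=
  fun a b => if a = u₀ ∧ b = v₀ then t else c a b

omit [Fintype ι] in
/-- `setCoupling` at the current value changes nothing. [folklore] -/
@[simp] theorem setCoupling_self (c : ι → ι → ℝ) (u₀ v₀ : ι) :
    setCoupling c u₀ v₀ (c u₀ v₀) = c := by
  funext a b
  unfold setCoupling
  split_ifs with h
  · rw [h.1, h.2]
  · rfl

/-- The reweighted total magnetisation `X = ∑_u λ_u σ_u`. [cite: CamiaJiangNewman2023, §1.2 eq. (12)] -/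
def weightedMagnetization (lam : ι → ℝ) (ρ : SpinConfig ι) : ℝ :=
  ∑ u, lam u * spinAt u ρ

/-- The complex **moment generating function** `⟨exp[h X]⟩_c`, `X = ∑_u λ_u σ_u`, `h ∈ ℂ`, of the
pair-interaction model: `(∑_σ e^{h X(σ)} w_c(σ)) / ∑_σ w_c(σ)` (`= Z_{G,J,hλ}/Z_G`, CJN eq. (8)
with the weights of Thm 2). [cite: CamiaJiangNewman2023, §1.2 eq. (8) and Thm 2] -/
def mgf (c : ι → ι → ℝ) (lam : ι → ℝ) (h : ℂ) : ℂ :=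
  (∑ ρ : SpinConfig ι, Complex.exp (h * (weightedMagnetization lam ρ : ℂ)) * (weight c ρ : ℂ)) /
    ((∑ ρ : SpinConfig ι, weight c ρ : ℝ) : ℂ)

/-- The moment generating function is `1` at `h = 0` (so `0` is never a zero and `α₁ > 0`).
[cite: CamiaJiangNewman2023, §1.2 eq. (9)] -/
theorem mgf_zero (c : ι → ι → ℝ) (lam : ι → ℝ) : mgf c lam 0 = 1 := by
  unfold mgf
  simp only [zero_mul, Complex.exp_zero, one_mul]
  rw [← Complex.ofReal_sum]
  exact div_self (Complex.ofReal_ne_zero.2 (sum_weight_pos c).ne')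

end PairIsing

/-! ### The named facts -/

/-- **Camia–Jiang–Newman 2023, Theorem 1 — monotonicity of Ursell functions (NAMED FACT, not
proved here).** Printed: "Let `G = (V,E)` be a finite graph and `J` be ferromagnetic pair
interactions on `G`. Then for any `k ∈ ℕ`, any `j₁, …, j_{2k} ∈ V` (`j_l`'s are not necessarily
distinct), any `u₀v₀ ∈ E`, we have `(-1)^{k-1} ∂u_{2k}(σ_{j₁},…,σ_{j_{2k}})/∂J_{u₀v₀} ≥ 0`."
VENDORED over `PairIsing.avg` (free b.c., zero field, ordered-pair couplings `c ≥ 0` on a finite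
set — every finite graph with `J ≥ 0` is the case `c = 0` off `E`; perturbing the single entry
`c u₀ v₀` perturbs `J_{u₀v₀}`): for `k ≥ 1`, sites `j : Fin (2k) → ι` and `u₀ ≠ v₀`,
`0 ≤ (-1)^{k-1} · d/dt|_{t = c u₀ v₀} u_{2k}(setCoupling c u₀ v₀ t; j)`. (By Remark 1 this implies
Shlosman's signs `(-1)^{k-1} u_{2k} ≥ 0` for distinct sites; also valid for the Griffiths–Simon
class — neither is asserted here.) [cite: CamiaJiangNewman2023, Thm 1] -/
def CamiaJiangNewman2023_thm1 : Prop :=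
  ∀ (ι : Type) [Fintype ι] [DecidableEq ι] (c : ι → ι → ℝ), (∀ a b, 0 ≤ c a b) →
    ∀ (k : ℕ), 1 ≤ k → ∀ (j : Fin (2 * k) → ι) (u₀ v₀ : ι), u₀ ≠ v₀ →
      0 ≤ (-1 : ℝ) ^ (k - 1) *
        deriv (fun t : ℝ => PairIsing.ursell (PairIsing.setCoupling c u₀ v₀ t) j) (c u₀ v₀)

/-- **Camia–Jiang–Newman 2023, Theorem 2 — the first Lee–Yang zero is antitone in the couplings
(Nishimori–Griffiths conjecture; NAMED FACT, not proved here).** Printed: "Let `G = (V,E)` be a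
finite graph, `J` and `J~` be ferromagnetic pair interactions on `G` satisfying
`0 ≤ J_{uv} ≤ J~_{uv}` for each `uv ∈ E`. Suppose that `{λ_u}_{u ∈ V}` is a collection of
nonnegative real numbers. Let `α₁(J)` (resp., `α₁(J~)`) be the modulus of the first zero of
`⟨exp[h ∑_{u∈V} λ_u σ_u]⟩_{G,J}` (resp., `…_{G,J~}`). Then we have `α₁(J) ≥ α₁(J~)`."
VENDORED over `PairIsing.mgf` in the equivalent ZERO FORM: for `0 ≤ c ≤ c'` entrywise and
`λ ≥ 0`, every zero `h ∈ ℂ` of the `c`-mgf has a zero `h'` of the `c'`-mgf with `‖h'‖ ≤ ‖h‖`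
(equivalent to the printed inequality whenever the first zeros exist — the paper's presupposition,
valid iff `λ ≢ 0` — and vacuous otherwise). The zeros are purely imaginary (generalised Lee–Yang,
Newman 1975 Thm 1, used in the printed proof) — not asserted here.
[cite: CamiaJiangNewman2023, Thm 2] -/
def CamiaJiangNewman2023_thm2 : Prop :=
  ∀ (ι : Type) [Fintype ι] [DecidableEq ι] (c c' : ι → ι → ℝ) (lam : ι → ℝ),
    (∀ a b, 0 ≤ c a b) → (∀ a b, c a b ≤ c' a b) → (∀ u, 0 ≤ lam u) →
      ∀ h : ℂ, PairIsing.mgf c lam h = 0 →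
        ∃ h' : ℂ, PairIsing.mgf c' lam h' = 0 ∧ ‖h'‖ ≤ ‖h‖

/-- Corollary 1 of CJN (`λ ≡ 1`: the first zero of the partition function `Z_{G,J,h}` itself is
antitone in `J`), in zero form, from the fact. [cite: CamiaJiangNewman2023, Cor 1] -/
theorem CamiaJiangNewman2023_cor1 (h2 : CamiaJiangNewman2023_thm2) (ι : Type) [Fintype ι]
    [DecidableEq ι] (c c' : ι → ι → ℝ) (hc : ∀ a b, 0 ≤ c a b) (hcc' : ∀ a b, c a b ≤ c' a b)
    (h : ℂ) (hz : PairIsing.mgf c (fun _ => 1) h = 0) :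
    ∃ h' : ℂ, PairIsing.mgf c' (fun _ => 1) h' = 0 ∧ ‖h'‖ ≤ ‖h‖ :=
  h2 ι c c' (fun _ => 1) hc hcc' (fun _ => zero_le_one) h hz

end Literature.Probability.LatticeModels
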